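import Mathlib
import Literature.Geometry.Manifold.InjOnNhdsOfCompact
import Literature.Geometry.Manifold.InjOnLocalDiffeomorphInverse

/-!
# Stub `stub_collarGermInjOpen` of line `einstein-bulk-transfer`
(crux `InformationMetricHadamard.AhHadamardFilling`)

Injectivity and openness of a collar germ: a `C¹` self-map `Ψ` of `M × ℝ` (`M` a closed smooth
4-manifold) with `Ψ(x,0) = (x,0)`, injective differential along `M × 0` and
`∂_λ (height ∘ Ψ) > 0` there is injective on a band `M × (-λ₁, λ₁)`, sends `M × (0, λ₁)` to
positive heights, has open images `Ψ(M × (0,t))`, `0 < t ≤ λ₁`, and each of them contains a band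
`M × (0, δ)`.

Proof: the differential at `(x,0)` is bijective (injective endomorphism of a finite-dimensional
space), so by the `C¹` inverse function theorem for manifolds
(`Literature.Geometry.Manifold.isLocalDiffeomorphAt_of_mfderiv`) `Ψ` is a local diffeomorphism at
every point of `M × 0`, hence (the set of such points being open; tube lemma over the compact `M`)
at every point of a band; it is injective on `M × 0`, hence
(`Literature.Geometry.Manifold.exists_isOpen_injOn_of_isCompact` + tube lemma) on a band.  On the
injectivity band the height `(Ψ(x,λ)).2` vanishes only at `λ = 0`, and for fixed `x` it has
positive `λ`-derivative at `λ = 0`; by the intermediate value theorem its sign is the sign of `λ`.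
Off `λ = 0` the map is `C^∞` with bijective differential on the band, so the images
`Ψ(M × (0,t))` are open (`Literature.Geometry.Manifold.isOpen_image_of_bijective_mfderiv`); the
bands `M × (0,δ)` inside them come from the local homeomorphism property at `M × 0` (tube lemma
again) and the sign rule.  Everything is proved (kind = proof); no definitions.
-/

noncomputable section

-- the prescribed namespace `Summit.<P>.<Sub>.…` duplicates `SmoothPoincare4` (P = Sub)
set_option linter.dupNamespace false

open scoped Manifold ContDiff Topology
open Set Function Bundle Filter

namespace Summit.SmoothPoincare4.SmoothPoincare4.Cruxes.AhHadamardFilling.EinsteinBulkTransfer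

/-! ### Generic helpers -/

section Tube

variable {M : Type*} [TopologicalSpace M] [CompactSpace M]

/-- Tube lemma over a compact space: an open subset of `M × ℝ` containing `M × 0` contains a band
`M × (-l, l)`. [folklore] -/
private theorem exists_band_subset_of_isOpen {O : Set (M × ℝ)} (hO : IsOpen O)
    (hsub : (univ : Set M) ×ˢ ({0} : Set ℝ) ⊆ O) :
    ∃ l : ℝ, 0 < l ∧ (univ : Set M) ×ˢ Ioo (-l) l ⊆ O := by
  obtain ⟨u, v, -, hv, hu, h0v, huv⟩ :=
    generalized_tube_lemma isCompact_univ isCompact_singleton hO hsub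
  obtain ⟨ε, hε, hball⟩ := Metric.isOpen_iff.1 hv 0 (h0v rfl)
  refine ⟨ε, hε, ?_⟩
  rintro ⟨x, t⟩ ⟨-, ht⟩
  refine huv ⟨hu (mem_univ x), hball ?_⟩
  rw [Real.ball_eq_Ioo, zero_sub, zero_add]
  exact ht

end Tube

section LocalDiffeo

variable {𝕜 : Type*} [NontriviallyNormedField 𝕜]
  {E : Type*} [NormedAddCommGroup E] [NormedSpace 𝕜 E]
  {F : Type*} [NormedAddCommGroup F] [NormedSpace 𝕜 F]
  {H : Type*} [TopologicalSpace H] {G : Type*} [TopologicalSpace G]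
  {I : ModelWithCorners 𝕜 E H} {J : ModelWithCorners 𝕜 F G}
  {X : Type*} [TopologicalSpace X] [ChartedSpace H X]
  {Y : Type*} [TopologicalSpace Y] [ChartedSpace G Y] {n : WithTop ℕ∞}

/-- A local diffeomorphism at `x` maps neighbourhoods of `x` to neighbourhoods of `f x`.
[folklore] -/
private theorem image_mem_nhds_of_isLocalDiffeomorphAt {f : X → Y} {x : X}
    (hf : IsLocalDiffeomorphAt I J n f x) {U : Set X} (hU : U ∈ 𝓝 x) : f '' U ∈ 𝓝 (f x) := by
  obtain ⟨Φ, hx, heq⟩ := hf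
  have h1 : Φ.toOpenPartialHomeomorph '' (U ∩ Φ.source) ∈ 𝓝 (Φ.toOpenPartialHomeomorph x) :=
    Φ.toOpenPartialHomeomorph.image_mem_nhds hx (inter_mem hU (Φ.open_source.mem_nhds hx))
  rw [heq hx]
  refine mem_of_superset h1 ?_
  rintro _ ⟨y, ⟨hyU, hys⟩, rfl⟩
  exact ⟨y, hyU, heq hys⟩

/-- A local diffeomorphism at `x` is injective on a neighbourhood of `x`. [folklore] -/
private theorem exists_injOn_of_isLocalDiffeomorphAt {f : X → Y} {x : X}
    (hf : IsLocalDiffeomorphAt I J n f x) : ∃ U ∈ 𝓝 x, InjOn f U := by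
  obtain ⟨Φ, hx, heq⟩ := hf
  exact ⟨Φ.source, Φ.open_source.mem_nhds hx, Φ.injOn.congr heq.symm⟩

/-- The set of points at which a map is a local diffeomorphism is open. [folklore] -/
private theorem isOpen_setOf_isLocalDiffeomorphAt (f : X → Y) :
    IsOpen {x | IsLocalDiffeomorphAt I J n f x} := by
  refine isOpen_iff_mem_nhds.2 fun x hx => ?_
  obtain ⟨Φ, hx, heq⟩ := hx
  exact mem_of_superset (Φ.open_source.mem_nhds hx) fun y hy => ⟨Φ, hy, heq⟩

end LocalDiffeo

section Sign

/-- A real function vanishing at `0` with positive derivative there is positive just to the right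
of `0`. [folklore] -/
private theorem eventually_nhdsGT_pos_of_hasDerivAt {g : ℝ → ℝ} {c : ℝ} (hg : HasDerivAt g c 0)
    (hc : 0 < c) (hg0 : g 0 = 0) : ∀ᶠ t in 𝓝[>] (0 : ℝ), 0 < g t := by
  have h := (hg.tendsto_slope_zero_right).eventually_const_lt hc
  filter_upwards [h, self_mem_nhdsWithin] with t ht (ht0 : 0 < t)
  rw [zero_add, hg0, sub_zero, smul_eq_mul] at ht
  exact pos_of_mul_pos_right ht (inv_pos.2 ht0).le


/-- A real function vanishing at `0` with positive derivative there is negative just to the left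
of `0`. [folklore] -/
private theorem eventually_nhdsLT_neg_of_hasDerivAt {g : ℝ → ℝ} {c : ℝ} (hg : HasDerivAt g c 0)
    (hc : 0 < c) (hg0 : g 0 = 0) : ∀ᶠ t in 𝓝[<] (0 : ℝ), g t < 0 := by
  have h := (hg.tendsto_slope_zero_left).eventually_const_lt hc
  filter_upwards [h, self_mem_nhdsWithin] with t ht (ht0 : t < 0)
  rw [zero_add, hg0, sub_zero, smul_eq_mul] at ht
  exact neg_of_mul_pos_right ht (inv_lt_zero.2 ht0).le

end Sign

/-! ### The stub -/

/-- **Injectivity and openness of a collar germ.** A `C¹` self-map `Ψ` of `M × ℝ` (`M` closed)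
(smooth off `λ = 0`) with `Ψ(x,0) = (x,0)`, injective differential along `M × 0` and
`∂_λ (height ∘ Ψ) > 0` there is injective on `M × (-λ₁, λ₁)`, sends `M × (0, λ₁)` to positive
heights with open images of the `M × (0,t)`, each containing a band `M × (0, δ)` (inverse function
theorem along the compact `M × 0`: tree `isLocalDiffeomorphAt_of_mfderiv`,
`exists_isOpen_injOn_of_isCompact`; tube lemma; intermediate value theorem for the sign of the
height). [folklore] -/
theorem stub_collarGermInjOpen
    (M : Type) [TopologicalSpace M] [T2Space M] [SecondCountableTopology M]
    [ChartedSpace (EuclideanSpace ℝ (Fin 4)) M] [IsManifold (𝓡 4) ∞ M] [CompactSpace M]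
    (Ψ : M × ℝ → M × ℝ) (hΨ : ContMDiff ((𝓡 4).prod 𝓘(ℝ, ℝ)) ((𝓡 4).prod 𝓘(ℝ, ℝ)) 1 Ψ)
    (hΨs : ContMDiffOn ((𝓡 4).prod 𝓘(ℝ, ℝ)) ((𝓡 4).prod 𝓘(ℝ, ℝ)) ∞ Ψ (univ ×ˢ {0}ᶜ))
    (hΨ0 : ∀ x : M, Ψ (x, 0) = (x, 0))
    (hinj : ∀ x : M, Injective (mfderiv ((𝓡 4).prod 𝓘(ℝ, ℝ)) ((𝓡 4).prod 𝓘(ℝ, ℝ)) Ψ (x, 0)))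
    (hpos : ∀ x : M,
      0 < (mfderiv ((𝓡 4).prod 𝓘(ℝ, ℝ)) ((𝓡 4).prod 𝓘(ℝ, ℝ)) Ψ (x, 0) ((0 : TangentSpace (𝓡 4) x), (1 : ℝ))).2) :
    ∃ l₁ : ℝ, 0 < l₁ ∧ InjOn Ψ (univ ×ˢ Ioo (-l₁) l₁) ∧
      (∀ p ∈ (univ : Set M) ×ˢ Ioo (0 : ℝ) l₁, 0 < (Ψ p).2) ∧
      (∀ t ∈ Ioc (0 : ℝ) l₁, IsOpen (Ψ '' (univ ×ˢ Ioo (0 : ℝ) t))) ∧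
      (∀ t ∈ Ioc (0 : ℝ) l₁, ∃ δ : ℝ, 0 < δ ∧ (univ : Set M) ×ˢ Ioo (0 : ℝ) δ ⊆ Ψ '' (univ ×ˢ Ioo (0 : ℝ) t)) := by
  -- the differential along `M × 0` is bijective (injective endomorphism in finite dimension)
  have hbij : ∀ x : M, Bijective (mfderiv ((𝓡 4).prod 𝓘(ℝ, ℝ)) ((𝓡 4).prod 𝓘(ℝ, ℝ)) Ψ (x, 0)) := by
    intro x
    refine ⟨hinj x, ?_⟩
    have h : Injective
        (show (EuclideanSpace ℝ (Fin 4) × ℝ) →ₗ[ℝ] (EuclideanSpace ℝ (Fin 4) × ℝ) from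
          (mfderiv ((𝓡 4).prod 𝓘(ℝ, ℝ)) ((𝓡 4).prod 𝓘(ℝ, ℝ)) Ψ (x, 0)).toLinearMap) := hinj x
    exact LinearMap.surjective_of_injective (K := ℝ) (V := EuclideanSpace ℝ (Fin 4) × ℝ) h
  -- `Ψ` is a `C¹` local diffeomorphism at the points of `M × 0` (inverse function theorem) ...
  have hloc0 : ∀ x : M,
      IsLocalDiffeomorphAt ((𝓡 4).prod 𝓘(ℝ, ℝ)) ((𝓡 4).prod 𝓘(ℝ, ℝ)) 1 Ψ (x, 0) := fun x =>
    Literature.Geometry.Manifold.isLocalDiffeomorphAt_of_mfderiv one_ne_zero isOpen_univ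
      (mem_univ _) hΨ.contMDiffOn
      (Literature.Geometry.Manifold.continuousLinearEquivOfBijective
        (E := EuclideanSpace ℝ (Fin 4) × ℝ) (E' := EuclideanSpace ℝ (Fin 4) × ℝ)
        (mfderiv ((𝓡 4).prod 𝓘(ℝ, ℝ)) ((𝓡 4).prod 𝓘(ℝ, ℝ)) Ψ (x, 0)) (hbij x))
      (Literature.Geometry.Manifold.coe_continuousLinearEquivOfBijective
        (E := EuclideanSpace ℝ (Fin 4) × ℝ) (E' := EuclideanSpace ℝ (Fin 4) × ℝ) _ (hbij x)).symm
  -- ... hence at the points of a band (the local-diffeomorphism locus is open; tube lemma)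
  obtain ⟨l₃, hl₃, hband₃⟩ : ∃ l : ℝ, 0 < l ∧
      (univ : Set M) ×ˢ Ioo (-l) l ⊆
        {p | IsLocalDiffeomorphAt ((𝓡 4).prod 𝓘(ℝ, ℝ)) ((𝓡 4).prod 𝓘(ℝ, ℝ)) 1 Ψ p} := by
    refine exists_band_subset_of_isOpen (isOpen_setOf_isLocalDiffeomorphAt Ψ) ?_
    rintro ⟨x, t⟩ ⟨-, ht⟩
    obtain rfl : t = 0 := ht
    exact hloc0 x
  -- injectivity on a band (injective on the compact `M × 0`, locally injective there)
  obtain ⟨l₀, hl₀, hinj₀⟩ : ∃ l : ℝ, 0 < l ∧ InjOn Ψ ((univ : Set M) ×ˢ Ioo (-l) l) := by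
    have hK : InjOn Ψ ((univ : Set M) ×ˢ ({0} : Set ℝ)) := by
      rintro ⟨x, t⟩ ⟨-, ht⟩ ⟨y, s⟩ ⟨-, hs⟩ hxy
      obtain rfl : t = 0 := ht
      obtain rfl : s = 0 := hs
      rwa [hΨ0, hΨ0] at hxy
    have hL : ∀ p ∈ (univ : Set M) ×ˢ ({0} : Set ℝ), ∃ U ∈ 𝓝 p, InjOn Ψ U := by
      rintro ⟨x, t⟩ ⟨-, ht⟩
      obtain rfl : t = 0 := ht
      exact exists_injOn_of_isLocalDiffeomorphAt (hloc0 x)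
    obtain ⟨O, hO, hKO, hinjO⟩ := Literature.Geometry.Manifold.exists_isOpen_injOn_of_isCompact
      (isCompact_univ.prod isCompact_singleton) hΨ.continuous hK hL
    obtain ⟨l, hl, hsub⟩ := exists_band_subset_of_isOpen hO hKO
    exact ⟨l, hl, hinjO.mono hsub⟩
  -- the `λ`-derivative of the height at `λ = 0`
  have hderiv : ∀ x : M, HasDerivAt (fun s : ℝ => (Ψ (x, s)).2)
      ((mfderiv ((𝓡 4).prod 𝓘(ℝ, ℝ)) ((𝓡 4).prod 𝓘(ℝ, ℝ)) Ψ (x, 0)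
        ((0 : TangentSpace (𝓡 4) x), (1 : ℝ))).2) 0 := by
    intro x
    have h1 : HasMFDerivAt 𝓘(ℝ, ℝ) ((𝓡 4).prod 𝓘(ℝ, ℝ)) (fun s : ℝ => (x, s)) 0
        (mfderiv 𝓘(ℝ, ℝ) ((𝓡 4).prod 𝓘(ℝ, ℝ)) (fun s : ℝ => (x, s)) 0) :=
      (mdifferentiableAt_const.prodMk mdifferentiableAt_id).hasMFDerivAt
    rw [mfderiv_prod_right] at h1
    have h2 : HasMFDerivAt ((𝓡 4).prod 𝓘(ℝ, ℝ)) ((𝓡 4).prod 𝓘(ℝ, ℝ)) Ψ (x, 0)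
        (mfderiv ((𝓡 4).prod 𝓘(ℝ, ℝ)) ((𝓡 4).prod 𝓘(ℝ, ℝ)) Ψ (x, 0)) :=
      (hΨ.mdifferentiableAt one_ne_zero).hasMFDerivAt
    have h3 := hasMFDerivAt_snd (I := 𝓡 4) (I' := 𝓘(ℝ, ℝ)) (Ψ (x, 0))
    -- the identification `TangentSpace 𝓘(ℝ, ℝ) 0 = ℝ` is by definitional unfolding
    set_option backward.isDefEq.respectTransparency false in
    exact (hasMFDerivAt_iff_hasFDerivAt.1 ((h3.comp (x, (0 : ℝ)) h2).comp (0 : ℝ) h1)).hasDerivAt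
  -- continuity of the height along the lines `λ ↦ (x, λ)`
  have hcont : ∀ x : M, Continuous (fun s : ℝ => (Ψ (x, s)).2) := fun x =>
    continuous_snd.comp (hΨ.continuous.comp (continuous_const.prodMk continuous_id))
  -- the width
  set l₁ : ℝ := min l₀ l₃
  have hl₁ : 0 < l₁ := lt_min hl₀ hl₃
  have hl₁₀ : l₁ ≤ l₀ := min_le_left _ _
  have hl₁₃ : l₁ ≤ l₃ := min_le_right _ _
  -- on the injectivity band the height vanishes only on `M × 0`
  have hne : ∀ (x : M) (t : ℝ), t ∈ Ioo (-l₁) l₁ → t ≠ 0 → (Ψ (x, t)).2 ≠ 0 := by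
    intro x t ht ht0 h0
    apply ht0
    have hmem : (x, t) ∈ (univ : Set M) ×ˢ Ioo (-l₀) l₀ :=
      ⟨mem_univ _, Ioo_subset_Ioo (neg_le_neg hl₁₀) hl₁₀ ht⟩
    have hmem' : ((Ψ (x, t)).1, (0 : ℝ)) ∈ (univ : Set M) ×ˢ Ioo (-l₀) l₀ :=
      ⟨mem_univ _, ⟨neg_lt_zero.2 hl₀, hl₀⟩⟩
    have heq : Ψ ((Ψ (x, t)).1, 0) = Ψ (x, t) := by
      rw [hΨ0]
      exact Prod.ext rfl h0.symm
    exact ((Prod.ext_iff.1 (hinj₀ hmem' hmem heq)).2).symm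
  -- sign rule, positive side
  have hposband : ∀ (x : M) (t : ℝ), t ∈ Ioo 0 l₁ → 0 < (Ψ (x, t)).2 := by
    intro x t ht
    have hev := eventually_nhdsGT_pos_of_hasDerivAt (hderiv x) (hpos x) (by simp [hΨ0])
    obtain ⟨s, hs_pos, hs⟩ := (hev.and (eventually_mem_set.2 (Ioo_mem_nhdsGT ht.1))).exists
    rcases lt_or_gt_of_ne (hne x t ⟨by linarith [ht.1], ht.2⟩ ht.1.ne') with hlt | hgt
    · exfalso
      obtain ⟨r, hr, hr0⟩ :=
        intermediate_value_Icc' hs.2.le (hcont x).continuousOn ⟨hlt.le, hs_pos.le⟩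
      exact hne x r ⟨by linarith [hr.1, hs.1], lt_of_le_of_lt hr.2 ht.2⟩
        (by linarith [hr.1, hs.1]) hr0
    · exact hgt
  -- sign rule, negative side
  have hnegband : ∀ (x : M) (t : ℝ), t ∈ Ioo (-l₁) 0 → (Ψ (x, t)).2 < 0 := by
    intro x t ht
    have hev := eventually_nhdsLT_neg_of_hasDerivAt (hderiv x) (hpos x) (by simp [hΨ0])
    obtain ⟨s, hs_neg, hs⟩ := (hev.and (eventually_mem_set.2 (Ioo_mem_nhdsLT ht.2))).exists
    rcases lt_or_gt_of_ne (hne x t ⟨ht.1, by linarith [ht.2]⟩ ht.2.ne) with hlt | hgt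
    · exact hlt
    · exfalso
      obtain ⟨r, hr, hr0⟩ :=
        intermediate_value_Icc' hs.1.le (hcont x).continuousOn ⟨hs_neg.le, hgt.le⟩
      exact hne x r ⟨lt_of_lt_of_le ht.1 hr.1, by linarith [hr.2, hs.2]⟩
        (by linarith [hr.2, hs.2]) hr0
  -- openness of the images of the half-bands: there `Ψ` is `C^∞` with bijective differential
  have hopen : ∀ t ∈ Ioc (0 : ℝ) l₁, IsOpen (Ψ '' (univ ×ˢ Ioo (0 : ℝ) t)) := by
    intro t ht
    refine Literature.Geometry.Manifold.isOpen_image_of_bijective_mfderiv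
      (isOpen_univ.prod isOpen_Ioo)
      (hΨs.mono (prod_mono Subset.rfl fun s hs => mem_compl_singleton_iff.2 hs.1.ne')) ?_
    rintro ⟨x, s⟩ ⟨-, hs⟩
    have hld : IsLocalDiffeomorphAt ((𝓡 4).prod 𝓘(ℝ, ℝ)) ((𝓡 4).prod 𝓘(ℝ, ℝ)) 1 Ψ (x, s) :=
      hband₃ ⟨mem_univ _, ⟨by linarith [hs.1], lt_of_lt_of_le hs.2 (ht.2.trans hl₁₃)⟩⟩
    rw [← hld.mfderivToContinuousLinearEquiv_coe one_ne_zero]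
    exact (hld.mfderivToContinuousLinearEquiv one_ne_zero).bijective
  -- bands inside the images
  have hbands : ∀ t ∈ Ioc (0 : ℝ) l₁, ∃ δ : ℝ, 0 < δ ∧
      (univ : Set M) ×ˢ Ioo (0 : ℝ) δ ⊆ Ψ '' (univ ×ˢ Ioo (0 : ℝ) t) := by
    intro t ht
    have hOnhds : (univ : Set M) ×ˢ ({0} : Set ℝ) ⊆
        interior (Ψ '' ((univ : Set M) ×ˢ Ioo (-t) t)) := by
      rintro ⟨x, s⟩ ⟨-, hs⟩
      obtain rfl : s = 0 := hs
      rw [mem_interior_iff_mem_nhds]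
      have hU : (univ : Set M) ×ˢ Ioo (-t) t ∈ 𝓝 (x, (0 : ℝ)) :=
        (isOpen_univ.prod isOpen_Ioo).mem_nhds ⟨mem_univ x, ⟨neg_lt_zero.2 ht.1, ht.1⟩⟩
      have h := image_mem_nhds_of_isLocalDiffeomorphAt (hloc0 x) hU
      rwa [hΨ0] at h
    obtain ⟨δ, hδ, hsub⟩ := exists_band_subset_of_isOpen isOpen_interior hOnhds
    refine ⟨δ, hδ, ?_⟩
    rintro ⟨y, μ⟩ ⟨-, hμ⟩
    obtain ⟨⟨x, s⟩, ⟨-, hs⟩, hxy⟩ :=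
      interior_subset (hsub ⟨mem_univ y, ⟨by linarith [hμ.1], hμ.2⟩⟩)
    refine ⟨(x, s), ⟨mem_univ _, ⟨?_, hs.2⟩⟩, hxy⟩
    by_contra hs0
    rcases (not_lt.1 hs0).lt_or_eq with hslt | hseq
    · have h := hnegband x s ⟨lt_of_le_of_lt (neg_le_neg ht.2) hs.1, hslt⟩
      rw [hxy] at h
      exact absurd hμ.1 (not_lt.2 h.le)
    · subst hseq
      rw [hΨ0] at hxy
      have := (Prod.ext_iff.1 hxy).2
      dsimp only at this
      linarith [hμ.1]
  refine ⟨l₁, hl₁, hinj₀.mono (prod_mono Subset.rfl (Ioo_subset_Ioo (neg_le_neg hl₁₀) hl₁₀)), ?_,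
    hopen, hbands⟩
  rintro ⟨x, t⟩ ⟨-, ht⟩
  exact hposband x t ht

end Summit.SmoothPoincare4.SmoothPoincare4.Cruxes.AhHadamardFilling.EinsteinBulkTransfer
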